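import Mathlib

/-!
# A kernel-checked counterexample: the separation-conditioned NEGATIVE association of two clusters
(van den Berg–Häggström–Kahn 2006, Theorems 1.5 / 2.1) does NOT extend to THREE pairwise-separated
roots (blind cell PercRepro2, p3 g13; proofs/P3-K3.md §2)

Van den Berg–Häggström–Kahn, *Some conditional correlation inequalities for percolation and related
processes*, Random Structures & Algorithms 29 (2006), doi:10.1002/rsa.20102, Theorem 1.5 (and
Theorem 2.1 for sets of roots): for bond percolation on a finite graph and roots `s ≠ t`, conditionally
on `Q = {s ↮ t}`, an increasing function of the cluster `C_s` and an increasing function of the cluster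
`C_t` are NEGATIVELY correlated.  The natural extension asks whether, for THREE roots `x₁, x₂, x₃`
conditioned on the PAIRWISE separation `S = {x₁ ↮ x₂} ∩ {x₁ ↮ x₃} ∩ {x₂ ↮ x₃}`, an increasing event of
`C(x₁)` and an increasing event of `C(x₂)` are still negatively correlated.

This file checks in the kernel that they are NOT: on the graph `G₇` on the vertices `0..6` with the
ten edges `{0,2}, {2,4}, {4,1}, {1,5}, {0,1}, {3,5}, {3,6}, {6,4}, {1,6}, {1,2}` (all with probability
`1/2`), roots `x₁ = 3`, `x₂ = 0`, `x₃ = 1`, and the events `A = {5 ∈ C(x₁) ∧ 6 ∈ C(x₁)}` (increasing in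
`C(x₁)`) and `B = {2 ∈ C(x₂)} ∪ {4 ∈ C(x₂) ∧ 6 ∈ C(x₂)}` (increasing in `C(x₂)`), counting
configurations (all `2^10` have the same weight):

  `#S = 174`, `#(A ∩ S) = 15`, `#(B ∩ S) = 45`, `#(A ∩ B ∩ S) = 4`,
  `P(A ∩ B | S) − P(A | S)·P(B | S) = 4/174 − (15/174)(45/174) = 21/30276 > 0`.

The control on the same graph with the single separation `Q = {x₁ ↮ x₂}` is negative, as Theorem 1.5
says: `#Q = 676`, `#(A ∩ Q) = 165`, `#(B ∩ Q) = 384`, `#(A ∩ B ∩ Q) = 54`,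
`54·676 − 165·384 = −26856 < 0`.  Mechanism: `A` (the cluster of `x₁` large) confines the cluster of
`x₃`, which frees the cluster of `x₂` — the third cluster mediates a POSITIVE correlation across the
first two (the competition graph of three mutually separated clusters is an odd cycle).  The four
counts are established by `decide +kernel` (standard axioms only); the inequalities follow by
`norm_num`.  Found by the cell's exact census (data/p3/g13/, two independent codes).
-/

namespace Summit.Ventures.PercRepro2.K3Cross

/-- The ten edges of the witness graph `G₇` (vertices `0..6`), as pairs. -/
def edge : Nat → Nat × Nat
  | 0 => (0, 2)
  | 1 => (2, 4)
  | 2 => (4, 1)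
  | 3 => (1, 5)
  | 4 => (0, 1)
  | 5 => (3, 5)
  | 6 => (3, 6)
  | 7 => (6, 4)
  | 8 => (1, 6)
  | _ => (1, 2)

/-- The three roots. -/
def x₁ : Nat := 3
/-- The second root. -/
def x₂ : Nat := 0
/-- The third root. -/
def x₃ : Nat := 1

/-- Edge `i` is open in the configuration `c ∈ [0, 2^10)` iff bit `i` of `c` is set. -/
def isOpen (c i : Nat) : Bool := c.testBit i

/-- Vertex sets are bitmasks over `0..6`; `mem S x` is `x ∈ S`. -/
def mem (S x : Nat) : Bool := S.testBit x

/-- One expansion step of a vertex set along the open (undirected) edges. -/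
def step (c S : Nat) : Nat :=
  (List.range 10).foldl (fun S i =>
    let e := edge i
    if isOpen c i then
      let S₁ := if mem S e.1 then S ||| (1 <<< e.2) else S
      if mem S₁ e.2 then S₁ ||| (1 <<< e.1) else S₁
    else S) S

/-- `n`-fold iteration of `step c`. -/
def iter (c : Nat) : Nat → Nat → Nat
  | 0, S => S
  | n + 1, S => iter c n (step c S)

/-- The open cluster `C(v)` of the vertex `v` in the configuration `c` (seven steps suffice on seven
vertices). -/
def cluster (c v : Nat) : Nat := iter c 7 (1 <<< v)

/-- The pairwise separation `S = {x₁ ↮ x₂} ∩ {x₁ ↮ x₃} ∩ {x₂ ↮ x₃}`. -/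
def sep3 (c : Nat) : Bool :=
  !(mem (cluster c x₁) x₂) && !(mem (cluster c x₁) x₃) && !(mem (cluster c x₂) x₃)

/-- The single separation `Q = {x₁ ↮ x₂}` of the control. -/
def sep2 (c : Nat) : Bool := !(mem (cluster c x₁) x₂)

/-- `A = {5 ∈ C(x₁) ∧ 6 ∈ C(x₁)}`, increasing in the cluster of `x₁`. -/
def A (c : Nat) : Bool := mem (cluster c x₁) 5 && mem (cluster c x₁) 6

/-- `B = {2 ∈ C(x₂)} ∪ {4 ∈ C(x₂) ∧ 6 ∈ C(x₂)}`, increasing in the cluster of `x₂`. -/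
def B (c : Nat) : Bool := mem (cluster c x₂) 2 || (mem (cluster c x₂) 4 && mem (cluster c x₂) 6)

/-- The four counts `(#S, #(A ∩ S), #(B ∩ S), #(A ∩ B ∩ S))` for a separation predicate `S`, in one
pass over the `2^10` configurations. -/
def counts (S : Nat → Bool) : Nat × Nat × Nat × Nat :=
  (List.range 1024).foldl (fun acc c =>
    if S c then
      let a := A c
      let b := B c
      (acc.1 + 1, acc.2.1 + (if a then 1 else 0), acc.2.2.1 + (if b then 1 else 0),
        acc.2.2.2 + (if a && b then 1 else 0))
    else acc) (0, 0, 0, 0)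

/-- The counts under the pairwise separation of the three roots. -/
theorem counts_sep3 : counts sep3 = (174, 15, 45, 4) := by decide +kernel

/-- The counts under the single separation `x₁ ↮ x₂` (the control). -/
theorem counts_sep2 : counts sep2 = (676, 165, 384, 54) := by decide +kernel

/-- The conditional covariance of `A` and `B` given the three pairwise separations is
`21/30276 > 0`: the events are POSITIVELY correlated. -/
theorem cov_sep3_pos :
    ((counts sep3).2.2.2 : ℚ) / (counts sep3).1 -
      ((counts sep3).2.1 / (counts sep3).1) * ((counts sep3).2.2.1 / (counts sep3).1) = 21 / 30276 := by
  rw [counts_sep3]; norm_num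

/-- **The three-root extension of BHK06 Theorem 1.5 is false**: on `G₇`,
`P(A ∩ B | S) > P(A | S) · P(B | S)` although `A` is increasing in `C(x₁)`, `B` is increasing in
`C(x₂)`, and `S` separates the three roots pairwise. -/
theorem three_root_negative_association_false :
    ((counts sep3).2.1 / (counts sep3).1 : ℚ) * ((counts sep3).2.2.1 / (counts sep3).1) <
      (counts sep3).2.2.2 / (counts sep3).1 := by
  rw [counts_sep3]; norm_num

/-- The control: with the single separation `x₁ ↮ x₂` the same two events are negatively correlated,
as Theorem 1.5 says (`54·676 − 165·384 = −26856`). -/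
theorem two_root_control :
    ((counts sep2).2.2.2 / (counts sep2).1 : ℚ) <
      ((counts sep2).2.1 / (counts sep2).1) * ((counts sep2).2.2.1 / (counts sep2).1) := by
  rw [counts_sep2]; norm_num

end Summit.Ventures.PercRepro2.K3Cross
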